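import Literature.Probability.RandomPlanarGeometry.SAWFixedEndpointMonotone
import HarnessLib

/-!
# Inserting a half-plane piece into a self-avoiding walk with fixed endpoint (`ℤ²`)

Topic `Literature/Probability/RandomPlanarGeometry` (continues `SAWFixedEndpointMonotone.lean`: Madras–Slade Lemma 7.3.3,
`Zd.ptSup`; `SAWCount.lean`: `Zd.sawFun`, `Zd.countAt`).

Source: N. Madras, G. Slade, *The Self-Avoiding Walk* (1993), proof of Lemma 7.3.3 (book p. 247: at the first time `j` of
maximal norm, `ω(j)` is not an endpoint, the step into `ω(j)` is the outer normal `v`, the step out of it is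
perpendicular, and the open half-space beyond `ω(j)` is free of the walk) combined with the concatenation device of
Corollary 3.2.6 / Proposition 7.4.4 (insert a self-avoiding piece in the free half-space).  We replace the two-step
push of Lemma 7.3.3 by the insertion of an ARBITRARY `m`-step self-avoiding piece `η : 0 → w` that stays in the closed
half-plane `{y : s·y_k ≥ 0}`: the step `ω(j) → ω(j+1) = ω(j) + w` becomes
`ω(j) → ω(j) + v → ω(j) + v + η(1) → ⋯ → ω(j) + v + w → ω(j) + w` (`v = s e_k` the outer normal).

## Main statements (namespace `Literature.Probability.RandomPlanarGeometry.SAW.Zd.PieceInsertion`)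

* `pieces m k s w` — the `m`-step self-avoiding pieces `0 → w` in the half-plane `{s·y_k ≥ 0}`;
* `card_core_mul_card_pieces_le` — for a fixed insertion time `j` and orientation, (walks in the core class) ×
  (pieces) injects into `(n+m+1)`-step walks with the same endpoint;
* `exists_core` — every `N`-step walk `0 → x` with `N ≥ (2‖x‖_∞+1)²` lies in some core class (8 orientations, `j < N`);
* **`countAt_mul_le`** — if `L ≤ #pieces m k s (t e_{k+1})` for all 8 orientations `(k, s, t)`, then
  `c_N(0,x) · L ≤ 8 N · c_{N+m+1}(0,x)` for every `N ≥ (2‖x‖_∞+1)²`.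
-/

noncomputable section

open Finset Literature.Probability.LatticeModels SimpleGraph

namespace Literature.Probability.RandomPlanarGeometry.SAW.Zd

namespace PieceInsertion

/-! ### Pieces, core classes, the splice -/

open Classical in
/-- The `m`-step self-avoiding pieces `η : 0 → w` staying in the closed half-plane `{y : s · y_k ≥ 0}`.
[cite: MadrasSlade1993, Corollary 3.2.6 (proof: "the translated polygon lies in the half-space")] -/
def pieces (m : ℕ) (k : Fin 2) (s : ℤ) (w : Site 2) : Finset (ℕ → Site 2) :=
  (sawFun 2 m w).filter fun η => ∀ i ≤ m, 0 ≤ s * η i k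

/-- Membership in `pieces`. [cite: MadrasSlade1993, Corollary 3.2.6 (proof: pieces in a half-space)] -/
theorem mem_pieces {m : ℕ} {k : Fin 2} {s : ℤ} {w : Site 2} {η : ℕ → Site 2} :
    η ∈ pieces m k s w ↔ η ∈ sawFun 2 m w ∧ ∀ i ≤ m, 0 ≤ s * η i k := by
  classical
  rw [pieces, Finset.mem_filter]

/-- The core class: at time `j < n` the walk is extremal in direction `s e_k` (`s ω(i)_k ≤ s ω(j)_k` for all
`i ≤ n`) and its next step is `w`. [cite: MadrasSlade1993, Lemma 7.3.3 (proof: the time `j`)] -/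
def Core (n : ℕ) (k : Fin 2) (s : ℤ) (w : Site 2) (j : ℕ) (ω : ℕ → Site 2) : Prop :=
  j < n ∧ (∀ i ≤ n, s * ω i k ≤ s * ω j k) ∧ ω (j + 1) = ω j + w

/-- The splice: insert `v`, then the translated piece, between times `j` and `j+1`.
[cite: MadrasSlade1993, Lemma 7.3.3 (proof: the walk `ω*`), Corollary 3.2.6 (proof: concatenation)] -/
def splice (j m : ℕ) (v : Site 2) (ω η : ℕ → Site 2) : ℕ → Site 2 := fun i =>
  if i ≤ j then ω i else if i ≤ j + 1 + m then ω j + v + η (i - (j + 1)) else ω (i - (m + 1))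

/-- Left inverse of the splice on the walk. [folklore] -/
def unspliceW (j m : ℕ) (ω' : ℕ → Site 2) : ℕ → Site 2 := fun i => if i ≤ j then ω' i else ω' (i + (m + 1))

/-- Left inverse of the splice on the piece. [folklore] -/
def unspliceP (j m : ℕ) (ω' : ℕ → Site 2) : ℕ → Site 2 := fun i => ω' (j + 1 + min i m) - ω' (j + 1)

variable {j m n : ℕ} {v w x : Site 2} {ω η : ℕ → Site 2} {k : Fin 2} {s : ℤ}
/-- Values of the splice before the insertion. [folklore] -/
private theorem splice_of_le {i : ℕ} (h : i ≤ j) : splice j m v ω η i = ω i := by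
  simp [splice, h]
/-- Values of the splice inside the inserted piece. [folklore] -/
private theorem splice_mid {i : ℕ} (h1 : j + 1 ≤ i) (h2 : i ≤ j + 1 + m) :
    splice j m v ω η i = ω j + v + η (i - (j + 1)) := by
  simp [splice, show ¬ i ≤ j by omega, h2]
/-- Values of the splice after the insertion. [folklore] -/
private theorem splice_of_ge {i : ℕ} (h : j + m + 2 ≤ i) : splice j m v ω η i = ω (i - (m + 1)) := by
  simp [splice, show ¬ i ≤ j by omega, show ¬ i ≤ j + 1 + m by omega]
/-- `unspliceW` inverts the splice. [folklore] -/
private theorem unspliceW_splice : unspliceW j m (splice j m v ω η) = ω := by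
  funext i
  by_cases hi : i ≤ j
  · simp [unspliceW, hi, splice_of_le hi]
  · simp only [unspliceW, if_neg hi]
    rw [splice_of_ge (by omega)]
    congr 1; omega
/-- `unspliceP` inverts the splice on pieces (which start at `0` and are frozen from time `m`). [folklore] -/
private theorem unspliceP_splice (hη : η ∈ sawFun 2 m w) : unspliceP j m (splice j m v ω η) = η := by
  obtain ⟨h0, hend, -, -⟩ := mem_sawFun.1 hη
  funext i
  simp only [unspliceP]
  rw [splice_mid (by omega) (by omega), splice_mid le_rfl (by omega), Nat.sub_self, h0, add_zero,
    show j + 1 + min i m - (j + 1) = min i m by omega, add_sub_cancel_left]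
  rcases le_or_gt i m with h | h
  · rw [min_eq_left h]
  · rw [min_eq_right h.le, hend i h.le, hend m le_rfl]

/-! ### The spliced walk is self-avoiding with the same endpoint -/
/-- `s² = 1` for a sign. [folklore] -/
private theorem sq_sign (hs : s = 1 ∨ s = -1) : s * s = 1 := by
  rcases hs with rfl | rfl <;> norm_num
/-- `0 ~ s e_k` for a sign `s`. [folklore] -/
private theorem adj_zero_single (hs : s = 1 ∨ s = -1) : (zdGraph 2).Adj (0 : Site 2) (Pi.single k s) := by
  rw [zdGraph_adj_iff]
  rcases hs with rfl | rfl
  · exact ⟨k, Or.inl (by simp)⟩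
  · refine ⟨k, Or.inr ?_⟩
    rw [← Pi.single_add]; simp
/-- **Freshness**: points of the inserted piece lie strictly beyond the walk in direction `s e_k`.
[cite: MadrasSlade1993, Lemma 7.3.3 (proof: "the two added points have larger norm than any other points")] -/
private theorem fresh (hs : s = 1 ∨ s = -1) (hcore : Core n k s w j ω) (hη : η ∈ pieces m k s w)
    {a b : ℕ} (ha : a ≤ m) (hb : b ≤ n) : ω j + Pi.single k s + η a ≠ ω b := by
  intro h
  obtain ⟨-, hmax, -⟩ := hcore
  have h1 := (mem_pieces.1 hη).2 a ha
  have h2 := hmax b hb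
  have h3 := congrArg (fun y : Site 2 => s * y k) h
  simp only [Pi.add_apply, Pi.single_eq_same, mul_add] at h3
  have h4 := sq_sign hs
  linarith

/-- **The spliced walk is an `(n+m+1)`-step self-avoiding walk `0 → x`.**
[cite: MadrasSlade1993, Lemma 7.3.3 (proof: "ω* is self-avoiding, and has the same endpoints as ω"), Corollary 3.2.6 (proof)] -/
theorem splice_mem_sawFun (hs : s = 1 ∨ s = -1) (hcore : Core n k s w j ω) (hω : ω ∈ sawFun 2 n x)
    (hη : η ∈ pieces m k s w) : splice j m (Pi.single k s) ω η ∈ sawFun 2 (n + m + 1) x := by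
  obtain ⟨h0, hend, hadj, hinj⟩ := mem_sawFun.1 hω
  obtain ⟨hηs, -⟩ := mem_pieces.1 hη
  obtain ⟨hη0, hηend, hηadj, hηinj⟩ := mem_sawFun.1 hηs
  have hjn : j < n := hcore.1
  have hnext : ω (j + 1) = ω j + w := hcore.2.2
  set v : Site 2 := Pi.single k s with hv
  refine mem_sawFun.2 ⟨by rw [splice_of_le (Nat.zero_le _), h0], fun i hi => ?_, fun i hi => ?_, ?_⟩
  · rw [splice_of_ge (by omega), hend _ (by omega)]
  · -- adjacency
    rcases Nat.lt_or_ge i j with h | h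
    · rw [splice_of_le h.le, splice_of_le (by omega : i + 1 ≤ j)]; exact hadj i (by omega)
    rcases h.eq_or_lt with h | h
    · -- `i = j`: `ω j ~ ω j + v`
      rw [← h, splice_of_le le_rfl, splice_mid le_rfl (by omega), Nat.sub_self, hη0, add_zero]
      have := (zdGraph_adj_add_right 0 v (ω j)).2 (adj_zero_single (k := k) hs)
      simpa [add_comm] using this
    rcases Nat.lt_or_ge i (j + 1 + m) with h' | h'
    · -- inside the piece
      rw [splice_mid (by omega) h'.le, splice_mid (by omega) (by omega),
        show i + 1 - (j + 1) = i - (j + 1) + 1 by omega, add_comm (ω j + v), add_comm (ω j + v),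
        zdGraph_adj_add_right]
      exact hηadj _ (by omega)
    rcases h'.eq_or_lt with h' | h'
    · -- `i = j+1+m`: `ω j + v + w ~ ω j + w = ω (j+1)`
      rw [← h', splice_mid (by omega) le_rfl, splice_of_ge (by omega),
        show j + 1 + m - (j + 1) = m by omega, hηend m le_rfl,
        show j + 1 + m + 1 - (m + 1) = j + 1 by omega, hnext]
      have := (zdGraph_adj_add_right v 0 (ω j + w)).2 (adj_zero_single (k := k) hs).symm
      simpa [add_comm, add_assoc, add_left_comm] using this
    · rw [splice_of_ge (by omega), splice_of_ge (by omega), show i + 1 - (m + 1) = i - (m + 1) + 1 by omega]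
      exact hadj _ (by omega)
  · -- injectivity on `[0, n+m+1]`
    intro a ha b hb hab
    simp only [Set.mem_setOf_eq] at ha hb
    have hval : ∀ i ≤ n + m + 1,
        (i ≤ j ∧ splice j m v ω η i = ω i) ∨
          (j + 1 ≤ i ∧ i ≤ j + 1 + m ∧ splice j m v ω η i = ω j + v + η (i - (j + 1))) ∨
          (j + m + 2 ≤ i ∧ splice j m v ω η i = ω (i - (m + 1))) := by
      intro i hi
      rcases Nat.lt_or_ge i (j + 1) with h | h
      · exact Or.inl ⟨by omega, splice_of_le (by omega)⟩
      rcases Nat.lt_or_ge i (j + m + 2) with h' | h'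
      · exact Or.inr (Or.inl ⟨h, by omega, splice_mid h (by omega)⟩)
      · exact Or.inr (Or.inr ⟨h', splice_of_ge h'⟩)
    have hF : ∀ {c d : ℕ}, c ≤ m → d ≤ n → ω j + v + η c ≠ ω d := fun hc hd => fresh hs hcore hη hc hd
    rcases hval a ha with ⟨a1, e1⟩ | ⟨a1, a1', e1⟩ | ⟨a1, e1⟩ <;>
      rcases hval b hb with ⟨b1, e2⟩ | ⟨b1, b1', e2⟩ | ⟨b1, e2⟩ <;>
      rw [e1, e2] at hab
    · exact hinj (show a ≤ n by omega) (show b ≤ n by omega) hab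
    · exact absurd hab.symm (hF (by omega) (by omega))
    · have := hinj (show a ≤ n by omega) (show b - (m + 1) ≤ n by omega) hab; omega
    · exact absurd hab (hF (by omega) (by omega))
    · have := hηinj (show a - (j + 1) ≤ m by omega) (show b - (j + 1) ≤ m by omega) (add_left_cancel hab)
      omega
    · exact absurd hab (hF (by omega) (by omega))
    · have := hinj (show a - (m + 1) ≤ n by omega) (show b ≤ n by omega) hab; omega
    · exact absurd hab.symm (hF (by omega) (by omega))
    · have := hinj (show a - (m + 1) ≤ n by omega) (show b - (m + 1) ≤ n by omega) hab; omega

/-! ### Counting: one core class times the pieces -/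

open Classical in
/-- **For a fixed insertion time and orientation, (core class) × (pieces) injects into the `(n+m+1)`-step walks
`0 → x`.** [cite: MadrasSlade1993, Lemma 7.3.3 (proof: "No two ω's can give rise to the same ω*"), Corollary 3.2.6 (eq. (3.2.11))] -/
theorem card_core_mul_card_pieces_le (hs : s = 1 ∨ s = -1) (n m j : ℕ) (k : Fin 2) (w x : Site 2) :
    ((sawFun 2 n x).filter (Core n k s w j)).card * (pieces m k s w).card ≤ countAt 2 (n + m + 1) x := by
  rw [← Finset.card_product, ← card_sawFun]
  refine Finset.card_le_card_of_injOn (fun p => splice j m (Pi.single k s) p.1 p.2) (fun p hp => ?_) ?_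
  · rw [Finset.mem_coe, Finset.mem_product, Finset.mem_filter] at hp
    exact splice_mem_sawFun hs hp.1.2 hp.1.1 hp.2
  · rintro ⟨ω₁, η₁⟩ h₁ ⟨ω₂, η₂⟩ h₂ h
    rw [Finset.mem_coe, Finset.mem_product, Finset.mem_filter] at h₁ h₂
    have hη₁ : η₁ ∈ sawFun 2 m w := (mem_pieces.1 h₁.2).1
    have hη₂ : η₂ ∈ sawFun 2 m w := (mem_pieces.1 h₂.2).1
    have e : splice j m (Pi.single k s) ω₁ η₁ = splice j m (Pi.single k s) ω₂ η₂ := h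
    have hω : ω₁ = ω₂ := by
      rw [← unspliceW_splice (j := j) (m := m) (v := Pi.single k s) (ω := ω₁) (η := η₁), e, unspliceW_splice]
    have hη : η₁ = η₂ := by
      rw [← unspliceP_splice (j := j) (v := Pi.single k s) (ω := ω₁) hη₁, e, unspliceP_splice hη₂]
    rw [hω, hη]

/-! ### Every long walk lies in a core class -/
/-- `‖y‖_∞ ≤ A` iff every coordinate is at most `A` in absolute value. [folklore] -/
private theorem ptSup_le_iff' {d : ℕ} {y : Site d} {A : ℕ} : ptSup y ≤ A ↔ ∀ i, (y i).natAbs ≤ A := by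
  unfold ptSup
  rw [Finset.sup_le_iff]
  simp

/-- For `N ≥ (2‖x‖_∞+1)²` an `N`-step self-avoiding walk `0 → x` on `ℤ²` has a point with a coordinate exceeding
`‖x‖_∞` in absolute value. [cite: MadrasSlade1993, Lemma 7.3.3 (proof: "at least one point of ω must lie outside the cube")] -/
theorem exists_natAbs_gt (hω : ω ∈ sawFun 2 n x) (hn : (2 * ptSup x + 1) ^ 2 ≤ n) :
    ∃ i, i ≤ n ∧ ∃ k : Fin 2, ptSup x < (ω i k).natAbs := by
  classical
  by_contra h
  push Not at h
  obtain ⟨-, -, -, hinj⟩ := mem_sawFun.1 hω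
  have hsub : (Finset.range (n + 1)).image ω ⊆ box 2 (ptSup x) := by
    intro y hy
    obtain ⟨i, hi, rfl⟩ := Finset.mem_image.1 hy
    rw [mem_box]
    intro l
    have := h i (Nat.le_of_lt_succ (Finset.mem_range.1 hi)) l
    constructor <;> omega
  have hcard : ((Finset.range (n + 1)).image ω).card = n + 1 := by
    rw [Finset.card_image_of_injOn, Finset.card_range]
    intro a ha b hb hab
    exact hinj (Nat.le_of_lt_succ (Finset.mem_range.1 ha)) (Nat.le_of_lt_succ (Finset.mem_range.1 hb)) hab
  have := Finset.card_le_card hsub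
  rw [hcard, card_box] at this
  omega
/-- In `Fin 2`, the index different from `k` is `k + 1`. [folklore] -/
private theorem fin_two_eq_add_one {i k : Fin 2} (h : i ≠ k) : i = k + 1 := by
  revert i k; decide

/-- **Every `N`-step self-avoiding walk `0 → x` with `N ≥ (2‖x‖_∞+1)²` lies in a core class** `Core N k s (t e_{k+1}) j`
with `j < N` and signs `s, t` (the first time the walk is farthest in the direction `s e_k` of a coordinate record).
[cite: MadrasSlade1993, Lemma 7.3.3 (proof: "j ≠ 0, N … we must have ω_i(j) = ω_i(j+1)")] -/
theorem exists_core (hω : ω ∈ sawFun 2 n x) (hn : (2 * ptSup x + 1) ^ 2 ≤ n) :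
    ∃ k : Fin 2, ∃ s t : ℤ, ∃ j : ℕ, (s = 1 ∨ s = -1) ∧ (t = 1 ∨ t = -1) ∧ j < n ∧
      Core n k s (Pi.single (k + 1) t) j ω := by
  classical
  obtain ⟨h0, hend, hadj, hinj⟩ := mem_sawFun.1 hω
  obtain ⟨i₀, hi₀, k, hk⟩ := exists_natAbs_gt hω hn
  -- the sign `s` with `s ω(i₀)_k = |ω(i₀)_k| > ‖x‖_∞`
  obtain ⟨s, hs, hsi₀⟩ : ∃ s : ℤ, (s = 1 ∨ s = -1) ∧ s * ω i₀ k = (ω i₀ k).natAbs := by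
    rcases le_or_gt 0 (ω i₀ k) with h | h
    · exact ⟨1, Or.inl rfl, by rw [one_mul]; exact (Int.natAbs_of_nonneg h).symm ▸ rfl⟩
    · exact ⟨-1, Or.inr rfl, by rw [Int.ofNat_natAbs_of_nonpos h.le]; ring⟩
  have hss := sq_sign hs
  -- the directional maximum `D` and its first attainment time `j`
  obtain ⟨i₁, hi₁, hmax⟩ := Finset.exists_max_image (Finset.range (n + 1)) (fun i => s * ω i k) ⟨0, by simp⟩
  set D := s * ω i₁ k with hD
  have hmax' : ∀ i ≤ n, s * ω i k ≤ D := fun i hi => hmax i (Finset.mem_range.2 (Nat.lt_succ_of_le hi))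
  have hex : ∃ j, j ≤ n ∧ s * ω j k = D := ⟨i₁, Nat.le_of_lt_succ (Finset.mem_range.1 hi₁), rfl⟩
  set j := Nat.find hex with hj
  obtain ⟨hjn, hjD⟩ : j ≤ n ∧ s * ω j k = D := Nat.find_spec hex
  have hlt : ∀ i < j, s * ω i k < D := by
    intro i hi
    have h1 := Nat.find_min hex hi
    have h2 := hmax' i (by omega)
    rcases h2.eq_or_lt with h | h
    · exact absurd ⟨by omega, h⟩ h1
    · exact h
  -- `D > ‖x‖_∞ ≥ 0`, so `j ≠ 0` and `j ≠ n`
  have hDA : (ptSup x : ℤ) < D := by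
    have := hmax' i₀ hi₀; omega
  have hj0 : j ≠ 0 := by
    intro h
    have := hjD; rw [h, h0] at this; simp at this
    have : (0 : ℤ) ≤ ptSup x := Nat.cast_nonneg _
    omega
  have hjN : j ≠ n := by
    intro h
    have h1 := hjD
    rw [h, hend n le_rfl] at h1
    have h2 : s * x k ≤ (x k).natAbs := by
      rcases hs with rfl | rfl
      · rw [one_mul]; exact Int.le_natAbs
      · have := Int.le_natAbs (a := -x k); rw [Int.natAbs_neg] at this; linarith
    have h3 : (x k).natAbs ≤ ptSup x := Finset.le_sup (f := fun i => (x i).natAbs) (Finset.mem_univ k)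
    have h4 : ((x k).natAbs : ℤ) ≤ ptSup x := by exact_mod_cast h3
    omega
  -- the step into `ω j` is `s e_k`
  have hprev : ω (j - 1) = ω j - Pi.single k s := by
    obtain ⟨i, hi⟩ := (zdGraph_adj_iff _ _).1 (hadj (j - 1) (by omega))
    rw [show j - 1 + 1 = j by omega] at hi
    have hltj := hlt (j - 1) (by omega)
    by_cases hik : i = k
    · subst hik
      rcases hi with hi | hi
      · -- `ω j = ω (j-1) + e_i`: then `s = 1`
        have e : ω j i = ω (j - 1) i + 1 := by rw [hi]; simp
        rcases hs with rfl | rfl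
        · rw [hi]; simp
        · exfalso; rw [e] at hjD; linarith
      · -- `ω (j-1) = ω j + e_i`: then `s = -1`
        have e : ω (j - 1) i = ω j i + 1 := by rw [hi]; simp
        rcases hs with rfl | rfl
        · exfalso; rw [e] at hltj; linarith
        · rw [hi, sub_eq_add_neg, ← Pi.single_neg, neg_neg]
    · exfalso
      have e : ω (j - 1) k = ω j k := by
        rcases hi with hi | hi
        · rw [hi]; simp [Ne.symm hik]
        · rw [hi]; simp [Ne.symm hik]
      rw [e] at hltj; linarith
  -- the step out of `ω j` is perpendicular: `t e_{k+1}`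
  obtain ⟨i, hi⟩ := (zdGraph_adj_iff _ _).1 (hadj j (by omega))
  have hik : i ≠ k := by
    intro hik
    subst hik
    have hnx := hmax' (j + 1) (by omega)
    rcases hi with hi | hi
    · -- `ω (j+1) = ω j + e_i`
      have e : ω (j + 1) i = ω j i + 1 := by rw [hi]; simp
      rcases hs with rfl | rfl
      · rw [e] at hnx; linarith
      · -- `s = -1`: then `ω (j+1) = ω (j-1)`
        have : ω (j + 1) = ω (j - 1) := by
          rw [hi, hprev, sub_eq_add_neg, ← Pi.single_neg, neg_neg]
        have := hinj (show j + 1 ≤ n by omega) (show j - 1 ≤ n by omega) this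
        omega
    · have e : ω j i = ω (j + 1) i + 1 := by rw [hi]; simp
      rcases hs with rfl | rfl
      · have : ω (j + 1) = ω (j - 1) := by
          rw [hprev, eq_sub_iff_add_eq, ← hi]
        have := hinj (show j + 1 ≤ n by omega) (show j - 1 ≤ n by omega) this
        omega
      · linarith
  have hik' := fin_two_eq_add_one hik
  subst hik'
  rcases hi with hi | hi
  · refine ⟨k, s, 1, j, hs, Or.inl rfl, by omega, by omega, fun i hi' => ?_, hi⟩
    rw [hjD]; exact hmax' i hi'
  · refine ⟨k, s, -1, j, hs, Or.inr rfl, by omega, by omega, fun i hi' => ?_, ?_⟩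
    · rw [hjD]; exact hmax' i hi'
    · rw [hi, add_assoc, ← Pi.single_add]; simp

/-! ### The insertion inequality -/
/-- The eight orientations `(k, s, t)`. [folklore] -/
private def orients : Finset (Fin 2 × ℤ × ℤ) :=
  (Finset.univ : Finset (Fin 2)) ×ˢ (({1, -1} : Finset ℤ) ×ˢ ({1, -1} : Finset ℤ))
/-- There are eight orientations. [folklore] -/
private theorem card_orients : orients.card = 8 := by
  rw [orients, Finset.card_product, Finset.card_product]
  simp

open Classical in
/-- **The insertion inequality.** If every one of the eight piece families `pieces m k s (t e_{k+1})` has at least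
`L` members, then `c_N(0,x) · L ≤ 8 N · c_{N+m+1}(0,x)` for every `N ≥ (2‖x‖_∞ + 1)²`.
[cite: MadrasSlade1993, Corollary 3.2.6, eq. (3.2.11) (concatenation lower bound for c_N(0,x)); Lemma 7.3.3 (proof)] -/
theorem countAt_mul_le {x : Site 2} {n m L : ℕ} (hn : (2 * ptSup x + 1) ^ 2 ≤ n)
    (hL : ∀ (k : Fin 2) (s t : ℤ), (s = 1 ∨ s = -1) → (t = 1 ∨ t = -1) → L ≤ (pieces m k s (Pi.single (k + 1) t)).card) :
    countAt 2 n x * L ≤ 8 * n * countAt 2 (n + m + 1) x := by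
  -- cover `sawFun 2 n x` by the core classes
  set C : Fin 2 × ℤ × ℤ → ℕ → Finset (ℕ → Site 2) :=
    fun o j => (sawFun 2 n x).filter (Core n o.1 o.2.1 (Pi.single (o.1 + 1) o.2.2) j) with hC
  have hcover : sawFun 2 n x ⊆ orients.biUnion fun o => (Finset.range n).biUnion fun j => C o j := by
    intro ω hω
    obtain ⟨k, s, t, j, hs, ht, hj, hcore⟩ := exists_core hω hn
    rw [Finset.mem_biUnion]
    refine ⟨(k, s, t), ?_, ?_⟩
    · rw [orients, Finset.mem_product, Finset.mem_product]
      refine ⟨Finset.mem_univ _, ?_, ?_⟩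
      · rcases hs with rfl | rfl <;> simp
      · rcases ht with rfl | rfl <;> simp
    · rw [Finset.mem_biUnion]
      exact ⟨j, Finset.mem_range.2 hj, Finset.mem_filter.2 ⟨hω, hcore⟩⟩
  have hmem : ∀ o ∈ orients, (o.2.1 = 1 ∨ o.2.1 = -1) ∧ (o.2.2 = 1 ∨ o.2.2 = -1) := by
    intro o ho
    rw [orients, Finset.mem_product, Finset.mem_product] at ho
    obtain ⟨-, h1, h2⟩ := ho
    simp only [Finset.mem_insert, Finset.mem_singleton] at h1 h2
    exact ⟨h1, h2⟩
  have h1 : countAt 2 n x ≤ ∑ o ∈ orients, ∑ j ∈ Finset.range n, (C o j).card := by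
    rw [← card_sawFun]
    refine (Finset.card_le_card hcover).trans (Finset.card_biUnion_le.trans (Finset.sum_le_sum fun o _ => ?_))
    exact Finset.card_biUnion_le
  have h2 : ∀ o ∈ orients, ∀ j ∈ Finset.range n, (C o j).card * L ≤ countAt 2 (n + m + 1) x := by
    intro o ho j _
    obtain ⟨hs, ht⟩ := hmem o ho
    calc (C o j).card * L ≤ (C o j).card * (pieces m o.1 o.2.1 (Pi.single (o.1 + 1) o.2.2)).card :=
          Nat.mul_le_mul_left _ (hL o.1 o.2.1 o.2.2 hs ht)
      _ ≤ countAt 2 (n + m + 1) x := card_core_mul_card_pieces_le hs n m j o.1 _ x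
  calc countAt 2 n x * L ≤ (∑ o ∈ orients, ∑ j ∈ Finset.range n, (C o j).card) * L := Nat.mul_le_mul_right _ h1
    _ = ∑ o ∈ orients, ∑ j ∈ Finset.range n, (C o j).card * L := by
        rw [Finset.sum_mul]; refine Finset.sum_congr rfl fun o _ => ?_; rw [Finset.sum_mul]
    _ ≤ ∑ o ∈ orients, ∑ j ∈ Finset.range n, countAt 2 (n + m + 1) x :=
        Finset.sum_le_sum fun o ho => Finset.sum_le_sum fun j hj => h2 o ho j hj
    _ = 8 * n * countAt 2 (n + m + 1) x := by
        rw [Finset.sum_const, Finset.sum_const, Finset.card_range, card_orients, smul_eq_mul, smul_eq_mul]; ring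

end PieceInsertion

end Literature.Probability.RandomPlanarGeometry.SAW.Zd
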